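import Summits.RiemannHypothesis.RiemannHypothesis.Theses.EtaLeadingQuarter
import Summits.RiemannHypothesis.RiemannHypothesis.Theorems.IntegerScrewNestedSylvester
import Literature.NumberTheory.LFunctions.ZetaScrewThm12Proofs
import Literature.NumberTheory.LFunctions.ZetaScrewGrowthMomentsProofs
import Literature.NumberTheory.LFunctions.SimpleZerosLevinsonProofs

/-!
# Route EtaLeadingQuarter — the support item `QuarterTrialVectors` (stmt-RiemannHypothesis-21793)

`QuarterTrialVectors : EtaLeadingSecondMoment → WeakLockingLayer → RH → ∀ ε > 0, ∀ᶠ M,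
  ∃ v ≠ 0, M · screwRayleigh M v ≤ 1/4 + ε`.

Proof (BRIEF-L18 §5, rh-idea-7's kernel-checked skeleton): trial vector `x_m := η_m + e_M(m)` on
`[2, M]` (`η_m = (−1)^m m^{−1/2}`, `e` the layer of `WeakLockingLayer`), `v i := x (i+2)`.
The Gram identity over the zeros (Suzuki2023 (1.9), tree `ZetaScrewThm12.hasSum_kernel`, with the
coordinate `m = 1` carrying `−1` so that `Σ_{[1,M]} y = 0` by exact locking) gives
`vᵀ S_M v = Σ_ρ w_ρ ‖T_M(γ_ρ) + E_M(γ_ρ)‖²` (`w_ρ = m(ρ)/γ_ρ²`, `T_M(γ) = −1 + Σ η_m m^{iγ}`,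
`E_M(γ) = Σ e_M(m) m^{iγ}`); `‖T+E‖² ≤ (1+δ)‖T‖² + (1+1/δ)‖E‖²` (tree `norm_add_sq_le_of_pos`);
`EtaLeadingSecondMoment` bounds `M Σ w‖T‖² ≤ (1/4+δ) log M`, `WeakLockingLayer` bounds
`M Σ w‖E‖² ≤ δ² log M` and `Σ e² ≤ δ² log M`; and `‖v‖² ≥ (1 − δ)(log M − 1) − δ log M` from
`Σ_{m=2}^{M} 1/m ≥ log M − 1` (Mathlib `log_add_one_le_harmonic`). With `δ = ε/(4 + 4ε)` this
gives `M · vᵀ S_M v ≤ (1/4 + ε) vᵀ v`.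

This closes the support item r9 of route EtaLeadingQuarter, a rung route onto the RH-free leaf
`ScrewFloorLimsupQuarter` (rung S-P(P1)); it is CONDITIONAL on its three hypotheses by signature and
proves nothing about RH. Nothing here bears on the truth of RH.
-/

noncomputable section

set_option linter.dupNamespace false  -- the mandated namespace repeats `RiemannHypothesis`

namespace Summit.RiemannHypothesis.RiemannHypothesis.Theorems.EtaLeadingQuarter.Trial

open Filter Topology Finset Matrix Literature.NumberTheory.LFunctions
open Summit.RiemannHypothesis.RiemannHypothesis.Theorems.IntegerScrew
open Summit.RiemannHypothesis.RiemannHypothesis.Theses.EtaLeadingQuarter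
open scoped BigOperators

/-! ## Re-indexing `Fin (M − 1) ↔ [2, M]` -/

/-- The trial vector's Gram value `vᵀ S_M v` is the route's double kernel sum over `[2, M]²`
(re-indexing `i ↔ m = i + 2`, tree `screwMatrix_form_eq_Icc`). [folklore] -/
theorem dotProduct_mulVec_screwMatrix (M : ℕ) (x : ℕ → ℝ) :
    (fun i : Fin (M - 1) => x ((i : ℕ) + 2)) ⬝ᵥ
        (screwMatrix (M - 1)).mulVec (fun i : Fin (M - 1) => x ((i : ℕ) + 2)) =
      ∑ m ∈ Icc 2 M, ∑ m' ∈ Icc 2 M,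
        zetaScrewKernel (Real.log m) (Real.log m') * (x m * x m') := by
  rcases M with _ | n
  · simp
  · have h := screwMatrix_form_eq_Icc n (fun i : Fin n => x ((i : ℕ) + 2)) x fun _ => rfl
    rw [star_trivial] at h
    exact h

/-- The trial vector's squared norm is `Σ_{m=2}^{M} x_m²`. [folklore] -/
theorem dotProduct_self_trial (M : ℕ) (x : ℕ → ℝ) :
    (fun i : Fin (M - 1) => x ((i : ℕ) + 2)) ⬝ᵥ (fun i : Fin (M - 1) => x ((i : ℕ) + 2)) =
      ∑ m ∈ Icc 2 M, x m ^ 2 := by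
  rcases M with _ | n
  · simp
  · have h := sum_Icc_two_eq_sum_fin (fun m => x m ^ 2) n
    simp only [dotProduct]
    rw [h]
    exact Finset.sum_congr rfl fun i _ => (sq _).symm

/-! ## Elementary inequalities -/

/-- `tsum` comparison against two summable majorants. [folklore] -/
theorem hasSum_le_of_le_add {ι : Type*} {q t u : ι → ℝ} {Q A B : ℝ} (hq : HasSum q Q)
    (ht : Summable t) (hu : Summable u)
    (hle : ∀ i, q i ≤ A * t i + B * u i) : Q ≤ A * ∑' i, t i + B * ∑' i, u i := by
  have h2 : HasSum (fun i => A * t i + B * u i) (A * ∑' i, t i + B * ∑' i, u i) :=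
    (ht.hasSum.mul_left A).add (hu.hasSum.mul_left B)
  exact hasSum_le hle hq h2

/-- Termwise AM–GM lower bound `(1 − δ)a² − b²/δ ≤ (a + b)²`. [folklore] -/
theorem sq_add_ge (a b : ℝ) {δ : ℝ} (hδ : 0 < δ) :
    (1 - δ) * a ^ 2 - (1 / δ) * b ^ 2 ≤ (a + b) ^ 2 := by
  have hδ' : δ ≠ 0 := hδ.ne'
  have hid : (a + b) ^ 2 - ((1 - δ) * a ^ 2 - (1 / δ) * b ^ 2) =
      (1 / δ) * (δ * a + b) ^ 2 + b ^ 2 := by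
    field_simp
    ring
  nlinarith [hid, sq_nonneg (δ * a + b), sq_nonneg b, one_div_pos.2 hδ,
    mul_nonneg (one_div_pos.2 hδ).le (sq_nonneg (δ * a + b))]

/-- `η_m² = 1/m` for `η_m = (−1)^m m^{−1/2}` (also at `m = 0`, where both sides are `0`).
[folklore] -/
theorem eta_sq (m : ℕ) : ((-1 : ℝ) ^ m * (m : ℝ) ^ (-(1 / 2 : ℝ))) ^ 2 = (m : ℝ)⁻¹ := by
  have hm0 : (0 : ℝ) ≤ m := Nat.cast_nonneg m
  rw [mul_pow, ← pow_mul, mul_comm m 2, pow_mul, neg_one_sq, one_pow, one_mul,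
    ← Real.rpow_natCast, ← Real.rpow_mul hm0, ← Real.rpow_neg_one]
  norm_num

/-- `Σ_{m=2}^{M} η_m² = Σ_{m=2}^{M} 1/m = H_M − 1 ≥ log M − 1` (Mathlib `log_add_one_le_harmonic`).
[folklore] -/
theorem log_sub_one_le_sum_eta_sq (M : ℕ) (hM : 2 ≤ M) :
    Real.log M - 1 ≤ ∑ m ∈ Icc 2 M, ((-1 : ℝ) ^ m * (m : ℝ) ^ (-(1 / 2 : ℝ))) ^ 2 := by
  simp only [eta_sq]
  have hIcc : Icc 1 M = insert 1 (Icc 2 M) := by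
    ext m
    simp only [Finset.mem_Icc, Finset.mem_insert]
    omega
  have hharm : (harmonic M : ℝ) = 1 + ∑ m ∈ Icc 2 M, (m : ℝ)⁻¹ := by
    rw [harmonic_eq_sum_Icc, hIcc]
    push_cast
    rw [Finset.sum_insert (by simp)]
    simp
  have h1 : Real.log M ≤ Real.log ((M + 1 : ℕ) : ℝ) := by
    have hM0 : (0 : ℝ) < M := by exact_mod_cast (by omega : 0 < M)
    exact Real.log_le_log hM0 (by push_cast; linarith)
  have h2 := log_add_one_le_harmonic M
  linarith

/-- `‖m^{iγ}‖ = 1` for `m ≥ 1`. [folklore] -/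
theorem norm_natCast_cpow_mul_I {m : ℕ} (hm : 0 < m) (γ : ℝ) :
    ‖(m : ℂ) ^ (((γ : ℝ) : ℂ) * Complex.I)‖ = 1 := by
  rw [Complex.norm_natCast_cpow_of_pos hm]
  simp

/-- Trivial bound for a coefficient sum: `‖Σ_{m=2}^{M} c_m m^{iγ}‖ ≤ Σ |c_m|`. [folklore] -/
theorem norm_sum_cpow_le (M : ℕ) (c : ℕ → ℝ) (γ : ℝ) :
    ‖∑ m ∈ Icc 2 M, ((c m : ℝ) : ℂ) * (m : ℂ) ^ (((γ : ℝ) : ℂ) * Complex.I)‖ ≤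
      ∑ m ∈ Icc 2 M, |c m| := by
  refine (norm_sum_le _ _).trans (Finset.sum_le_sum fun m hm => ?_)
  have hm0 : 0 < m := by have := (Finset.mem_Icc.mp hm).1; omega
  rw [norm_mul, Complex.norm_real, Real.norm_eq_abs, norm_natCast_cpow_mul_I hm0, mul_one]

/-- Trivial bound `‖−1 + Σ_{m=2}^{M} c_m m^{iγ}‖ ≤ 1 + Σ |c_m|`. [folklore] -/
theorem norm_neg_one_add_sum_cpow_le (M : ℕ) (c : ℕ → ℝ) (γ : ℝ) :
    ‖-1 + ∑ m ∈ Icc 2 M, ((c m : ℝ) : ℂ) * (m : ℂ) ^ (((γ : ℝ) : ℂ) * Complex.I)‖ ≤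
      1 + ∑ m ∈ Icc 2 M, |c m| := by
  refine (norm_add_le _ _).trans ?_
  rw [norm_neg, norm_one]
  linarith [norm_sum_cpow_le M c γ]

/-! ## The Gram identity over the zeros (the RH step) -/

/-- `m^{iγ} = cos(γ log m) + i sin(γ log m)` for `m ≥ 1`. [folklore] -/
theorem natCast_cpow_mul_I_eq (γ : ℝ) {m : ℕ} (hm : 1 ≤ m) :
    (m : ℂ) ^ (((γ : ℝ) : ℂ) * Complex.I) =
      (Real.cos (γ * Real.log m) : ℂ) + (Real.sin (γ * Real.log m) : ℂ) * Complex.I := by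
  have hm0 : (m : ℂ) ≠ 0 := Nat.cast_ne_zero.2 (by omega)
  rw [Complex.cpow_def_of_ne_zero hm0, ← Complex.natCast_log,
    show ((Real.log m : ℝ) : ℂ) * (((γ : ℝ) : ℂ) * Complex.I) =
        ((γ * Real.log m : ℝ) : ℂ) * Complex.I by
      push_cast; ring,
    Complex.exp_mul_I, ← Complex.ofReal_cos, ← Complex.ofReal_sin]

/-- Real and imaginary parts of `−1 + Σ_{m=2}^{M} x_m m^{iγ}` for real `x`. [folklore] -/
theorem re_im_neg_one_add_sum (M : ℕ) (x : ℕ → ℝ) (γ : ℝ) :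
    (-1 + ∑ m ∈ Icc 2 M, ((x m : ℝ) : ℂ) * (m : ℂ) ^ (((γ : ℝ) : ℂ) * Complex.I)).re =
        -1 + ∑ m ∈ Icc 2 M, x m * Real.cos (γ * Real.log m) ∧
      (-1 + ∑ m ∈ Icc 2 M, ((x m : ℝ) : ℂ) * (m : ℂ) ^ (((γ : ℝ) : ℂ) * Complex.I)).im =
        ∑ m ∈ Icc 2 M, x m * Real.sin (γ * Real.log m) := by
  have hterm : ∀ m ∈ Icc 2 M, ((x m : ℝ) : ℂ) * (m : ℂ) ^ (((γ : ℝ) : ℂ) * Complex.I) =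
      ((x m * Real.cos (γ * Real.log m) : ℝ) : ℂ) +
        ((x m * Real.sin (γ * Real.log m) : ℝ) : ℂ) * Complex.I := by
    intro m hm
    rw [natCast_cpow_mul_I_eq γ (by have := (Finset.mem_Icc.mp hm).1; omega)]
    push_cast
    ring
  rw [Finset.sum_congr rfl hterm, Complex.add_re, Complex.add_im, Complex.re_sum, Complex.im_sum]
  constructor
  · rw [Complex.neg_re, Complex.one_re]
    congr 1
    refine Finset.sum_congr rfl fun m _ => ?_
    simp only [Complex.add_re, Complex.mul_re, Complex.ofReal_re, Complex.ofReal_im, Complex.I_re,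
      Complex.I_im, mul_zero, zero_mul, sub_zero, add_zero]
  · rw [Complex.neg_im, Complex.one_im, neg_zero, zero_add]
    refine Finset.sum_congr rfl fun m _ => ?_
    simp only [Complex.add_im, Complex.mul_im, Complex.ofReal_re, Complex.ofReal_im, Complex.I_re,
      Complex.I_im, mul_zero, mul_one, add_zero, zero_add]

/-- **Gram identity in ordinate form (under RH).** For real `x` with `Σ_{m=2}^{M} x_m = 1`,
`HasSum (ρ ↦ m(ρ)/γ_ρ² · ‖−1 + Σ_{m=2}^{M} x_m m^{iγ_ρ}‖²) (Σ_{2≤m,m'≤M} G(log m, log m') x_m x_m')`: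
Suzuki2023 (1.9) (tree `ZetaScrewThm12.hasSum_kernel`) summed against `x_m x_{m'}`, and the
finite-sum algebra `Σ x_m x_m' (1 − cos θ_m − cos θ_m' + cos(θ_m − θ_m')) = (1 − C)² + S²`
(`C = Σ x_m cos θ_m`, `S = Σ x_m sin θ_m`, using `Σ x = 1`). [cite: Suzuki2023, (1.9)] -/
theorem hasSum_gram (hRH : _root_.RiemannHypothesis) (M : ℕ) (x : ℕ → ℝ)
    (hx : ∑ m ∈ Icc 2 M, x m = 1) :
    HasSum (fun ρ : ZetaZeros.riemannZetaNontrivialZeros =>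
        (riemannZetaZeroOrder (ρ : ℂ) : ℝ) / (ρ : ℂ).im ^ 2 *
          ‖-1 + ∑ m ∈ Icc 2 M, ((x m : ℝ) : ℂ) *
            (m : ℂ) ^ ((((ρ : ℂ).im : ℝ) : ℂ) * Complex.I)‖ ^ 2)
      (∑ m ∈ Icc 2 M, ∑ m' ∈ Icc 2 M,
        zetaScrewKernel (Real.log m) (Real.log m') * (x m * x m')) := by
  have hQ : HasSum (fun ρ : ZetaZeros.riemannZetaNontrivialZeros => ∑ m ∈ Icc 2 M, ∑ m' ∈ Icc 2 M,
      (riemannZetaZeroOrder (ρ : ℂ) : ℝ) / (ρ : ℂ).im ^ 2 *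
        (1 - Real.cos ((ρ : ℂ).im * Real.log m) - Real.cos ((ρ : ℂ).im * Real.log m')
          + Real.cos ((ρ : ℂ).im * Real.log m - (ρ : ℂ).im * Real.log m')) * (x m * x m'))
      (∑ m ∈ Icc 2 M, ∑ m' ∈ Icc 2 M,
        zetaScrewKernel (Real.log m) (Real.log m') * (x m * x m')) :=
    hasSum_sum fun m _ => hasSum_sum fun m' _ =>
      (ZetaScrewThm12.hasSum_kernel hRH (Real.log m) (Real.log m')).mul_right _
  refine hQ.congr_fun fun ρ => ?_
  set γ : ℝ := (ρ : ℂ).im with hγ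
  set mρ : ℝ := (riemannZetaZeroOrder (ρ : ℂ) : ℝ) with hmρ
  have key : ∑ m ∈ Icc 2 M, ∑ m' ∈ Icc 2 M, mρ / γ ^ 2 *
      (1 - Real.cos (γ * Real.log m) - Real.cos (γ * Real.log m')
        + Real.cos (γ * Real.log m - γ * Real.log m')) * (x m * x m')
      = mρ / γ ^ 2 *
        ((∑ m ∈ Icc 2 M, x m * (1 - Real.cos (γ * Real.log m))) *
            (∑ m ∈ Icc 2 M, x m * (1 - Real.cos (γ * Real.log m)))
          + (∑ m ∈ Icc 2 M, x m * Real.sin (γ * Real.log m)) *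
            (∑ m ∈ Icc 2 M, x m * Real.sin (γ * Real.log m))) := by
    simp_rw [Real.cos_sub]
    rw [Finset.sum_mul_sum, Finset.sum_mul_sum, ← Finset.sum_add_distrib, Finset.mul_sum]
    refine Finset.sum_congr rfl fun i _ => ?_
    rw [← Finset.sum_add_distrib, Finset.mul_sum]
    refine Finset.sum_congr rfl fun j _ => ?_
    ring
  rw [key]
  have hC : ∑ m ∈ Icc 2 M, x m * (1 - Real.cos (γ * Real.log m)) =
      1 - ∑ m ∈ Icc 2 M, x m * Real.cos (γ * Real.log m) := by
    simp only [mul_sub, mul_one, Finset.sum_sub_distrib, hx]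
  obtain ⟨hre, him⟩ := re_im_neg_one_add_sum M x γ
  rw [hC, Complex.sq_norm, Complex.normSq_apply, hre, him]
  ring

/-! ## Assembly -/

/-- **Item stmt-RiemannHypothesis-21793.** `EtaLeadingSecondMoment → WeakLockingLayer → RH →
∀ ε > 0, ∀ᶠ M, ∃ v ≠ 0, M · screwRayleigh M v ≤ 1/4 + ε` (trial vector `η + e_M` on `[2, M]`).
Conditional on its three hypotheses; nothing here bears on the truth of RH. [folklore] -/
theorem quarterTrialVectors_proof : QuarterTrialVectors := by
  intro h₁ h₂ hRH ε hε
  obtain ⟨e, he_lock, he_energy, he_zero⟩ := h₂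
  -- the auxiliary parameter δ = ε / (4 + 4ε) ∈ (0, 1/4]
  set δ : ℝ := ε / (4 + 4 * ε) with hδdef
  have hδ : 0 < δ := by positivity
  have hδ4 : δ ≤ 1 / 4 := by
    rw [hδdef, div_le_iff₀ (by positivity)]; nlinarith
  have hδsq : δ ^ 2 ≤ 1 / 4 * δ := by nlinarith [hδ, hδ4]
  have hδε : (1 / 4 + 3 * δ) ≤ (1 / 4 + ε) * (1 - 3 * δ) := by
    have : (1 / 4 + ε) * (1 - 3 * δ) - (1 / 4 + 3 * δ) = ε * (1 / 4 + ε) / (4 + 4 * ε) := by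
      rw [hδdef]; field_simp; ring
    have h0 : 0 ≤ ε * (1 / 4 + ε) / (4 + 4 * ε) := by positivity
    linarith
  -- the weights `m(ρ)/γ²` are summable and nonnegative (RH-free, tree)
  have hW : Summable fun ρ : ZetaZeros.riemannZetaNontrivialZeros =>
      (riemannZetaZeroOrder (ρ : ℂ) : ℝ) / (ρ : ℂ).im ^ 2 :=
    (ZetaScrewGrowth.summable_two_mul_order_div_im_sq.mul_left (1 / 2)).congr fun ρ => by ring
  have hWnn : ∀ ρ : ZetaZeros.riemannZetaNontrivialZeros,
      0 ≤ (riemannZetaZeroOrder (ρ : ℂ) : ℝ) / (ρ : ℂ).im ^ 2 := fun ρ =>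
    div_nonneg (FordL33.order_pos ρ).le (sq_nonneg _)
  -- (F1) K1 with ε := δ; (F3) energy; (F4) zero side of the layer; (F5) log M ≥ 1/δ
  have F1 := h₁ hRH δ hδ
  have hlog : Tendsto (fun M : ℕ => Real.log (M : ℝ)) atTop atTop :=
    Real.tendsto_log_atTop.comp tendsto_natCast_atTop_atTop
  have F3 : ∀ᶠ M : ℕ in atTop, (∑ m ∈ Icc 2 M, e M m ^ 2) / Real.log M < δ ^ 2 :=
    he_energy.eventually (gt_mem_nhds (by positivity))
  have F4 := he_zero.eventually (gt_mem_nhds (show (0 : ℝ) < δ ^ 2 by positivity))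
  have F5 : ∀ᶠ M : ℕ in atTop, 1 / δ ≤ Real.log (M : ℝ) := hlog.eventually_ge_atTop _
  filter_upwards [F1, he_lock, F3, F4, F5, eventually_ge_atTop 2] with M hF1 hF2 hF3 hF4 hF5 hM2
  -- notation: `L = log M`, the two zero-side functionals `ZT` (eta part) and `ZE` (layer part)
  set L : ℝ := Real.log (M : ℝ) with hL
  have hLpos : 0 < L := by
    have : (0 : ℝ) < 1 / δ := by positivity
    linarith
  have hMpos : (0 : ℝ) < M := by exact_mod_cast (by omega : 0 < M)
  obtain ⟨ZT, hZT⟩ : ∃ Z : ℝ, Z = ∑' ρ : ZetaZeros.riemannZetaNontrivialZeros,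
      (riemannZetaZeroOrder (ρ : ℂ) : ℝ) / (ρ : ℂ).im ^ 2 *
        ‖-1 + ∑ m ∈ Icc 2 M, ((((-1 : ℝ) ^ m * (m : ℝ) ^ (-(1 / 2 : ℝ))) : ℝ) : ℂ) *
          (m : ℂ) ^ ((((ρ : ℂ).im : ℝ) : ℂ) * Complex.I)‖ ^ 2 := ⟨_, rfl⟩
  obtain ⟨ZE, hZE⟩ : ∃ Z : ℝ, Z = ∑' ρ : ZetaZeros.riemannZetaNontrivialZeros,
      (riemannZetaZeroOrder (ρ : ℂ) : ℝ) / (ρ : ℂ).im ^ 2 *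
        ‖∑ m ∈ Icc 2 M, ((e M m : ℝ) : ℂ) *
          (m : ℂ) ^ ((((ρ : ℂ).im : ℝ) : ℂ) * Complex.I)‖ ^ 2 := ⟨_, rfl⟩
  have hF1' : (M : ℝ) * ZT ≤ (1 / 4 + δ) * L := by rw [hZT]; exact hF1
  have hF4' : (M : ℝ) / L * ZE < δ ^ 2 := by rw [hZE]; exact hF4
  -- the trial vector
  obtain ⟨x, hxdef⟩ : ∃ x : ℕ → ℝ,
      x = fun m : ℕ => (-1 : ℝ) ^ m * (m : ℝ) ^ (-(1 / 2 : ℝ)) + e M m := ⟨_, rfl⟩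
  have hxm : ∀ m : ℕ, x m = (-1 : ℝ) ^ m * (m : ℝ) ^ (-(1 / 2 : ℝ)) + e M m := fun m => by
    rw [hxdef]
  set v : Fin (M - 1) → ℝ := fun i => x ((i : ℕ) + 2) with hvdef
  have hx : ∑ m ∈ Icc 2 M, x m = 1 := by
    simp only [hxm, Finset.sum_add_distrib, hF2]
    ring
  -- Gram identity and the (1+δ) split
  have hG := hasSum_gram hRH M x hx
  have hQ : v ⬝ᵥ (screwMatrix (M - 1)).mulVec v =
      ∑ m ∈ Icc 2 M, ∑ m' ∈ Icc 2 M,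
        zetaScrewKernel (Real.log m) (Real.log m') * (x m * x m') :=
    dotProduct_mulVec_screwMatrix M x
  have ht : Summable fun ρ : ZetaZeros.riemannZetaNontrivialZeros =>
      (riemannZetaZeroOrder (ρ : ℂ) : ℝ) / (ρ : ℂ).im ^ 2 *
        ‖-1 + ∑ m ∈ Icc 2 M, ((((-1 : ℝ) ^ m * (m : ℝ) ^ (-(1 / 2 : ℝ))) : ℝ) : ℂ) *
          (m : ℂ) ^ ((((ρ : ℂ).im : ℝ) : ℂ) * Complex.I)‖ ^ 2 :=
    (hW.mul_right ((1 + ∑ m ∈ Icc 2 M, |(-1 : ℝ) ^ m * (m : ℝ) ^ (-(1 / 2 : ℝ))|) ^ 2)).of_nonneg_of_le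
      (fun ρ => mul_nonneg (hWnn ρ) (sq_nonneg _)) fun ρ =>
      mul_le_mul_of_nonneg_left
        (pow_le_pow_left₀ (norm_nonneg _)
          (norm_neg_one_add_sum_cpow_le M (fun m => (-1 : ℝ) ^ m * (m : ℝ) ^ (-(1 / 2 : ℝ))) _) 2)
        (hWnn ρ)
  have hu : Summable fun ρ : ZetaZeros.riemannZetaNontrivialZeros =>
      (riemannZetaZeroOrder (ρ : ℂ) : ℝ) / (ρ : ℂ).im ^ 2 *
        ‖∑ m ∈ Icc 2 M, ((e M m : ℝ) : ℂ) *
          (m : ℂ) ^ ((((ρ : ℂ).im : ℝ) : ℂ) * Complex.I)‖ ^ 2 :=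
    (hW.mul_right ((∑ m ∈ Icc 2 M, |e M m|) ^ 2)).of_nonneg_of_le
      (fun ρ => mul_nonneg (hWnn ρ) (sq_nonneg _)) fun ρ =>
      mul_le_mul_of_nonneg_left
        (pow_le_pow_left₀ (norm_nonneg _) (norm_sum_cpow_le M (e M) _) 2) (hWnn ρ)
  have hsplit : v ⬝ᵥ (screwMatrix (M - 1)).mulVec v ≤ (1 + δ) * ZT + (1 + 1 / δ) * ZE := by
    rw [hZT, hZE, hQ]
    refine hasSum_le_of_le_add hG ht hu fun ρ => ?_
    have hxs : -1 + ∑ m ∈ Icc 2 M, ((x m : ℝ) : ℂ) *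
          (m : ℂ) ^ ((((ρ : ℂ).im : ℝ) : ℂ) * Complex.I) =
        (-1 + ∑ m ∈ Icc 2 M, ((((-1 : ℝ) ^ m * (m : ℝ) ^ (-(1 / 2 : ℝ))) : ℝ) : ℂ) *
            (m : ℂ) ^ ((((ρ : ℂ).im : ℝ) : ℂ) * Complex.I)) +
          ∑ m ∈ Icc 2 M, ((e M m : ℝ) : ℂ) *
            (m : ℂ) ^ ((((ρ : ℂ).im : ℝ) : ℂ) * Complex.I) := by
      simp only [hxm, Complex.ofReal_add, add_mul, Finset.sum_add_distrib]
      ring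
    rw [hxs]
    refine (mul_le_mul_of_nonneg_left (norm_add_sq_le_of_pos _ _ hδ) (hWnn ρ)).trans_eq ?_
    ring
  -- numerator: M · vᵀ S v ≤ (1/4 + 3δ) L
  have hZe : (M : ℝ) * ZE ≤ δ ^ 2 * L := by
    have h := (mul_lt_mul_of_pos_right hF4' hLpos).le
    have : (M : ℝ) / L * ZE * L = (M : ℝ) * ZE := by
      field_simp
    linarith
  have hnum : (M : ℝ) * (v ⬝ᵥ (screwMatrix (M - 1)).mulVec v) ≤ (1 / 4 + 3 * δ) * L := by
    have h1 := mul_le_mul_of_nonneg_left hsplit hMpos.le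
    have step : (M : ℝ) * (v ⬝ᵥ (screwMatrix (M - 1)).mulVec v) ≤
        (1 + δ) * ((M : ℝ) * ZT) + (1 + 1 / δ) * ((M : ℝ) * ZE) := by
      linarith [h1]
    have e1 := mul_le_mul_of_nonneg_left hF1' (by positivity : (0 : ℝ) ≤ 1 + δ)
    have e2 := mul_le_mul_of_nonneg_left hZe (by positivity : (0 : ℝ) ≤ 1 + 1 / δ)
    have e2' : (1 + 1 / δ) * (δ ^ 2 * L) = δ ^ 2 * L + δ * L := by
      field_simp
    have e3 : δ ^ 2 * L ≤ 1 / 4 * δ * L := mul_le_mul_of_nonneg_right hδsq hLpos.le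
    have hδL0 : 0 ≤ δ * L := by positivity
    linarith only [step, e1, e2, e2', e3, hδL0]
  -- denominator: vᵀ v ≥ (1 − 3δ) L
  have hE : ∑ m ∈ Icc 2 M, e M m ^ 2 ≤ δ ^ 2 * L := by
    have := (div_lt_iff₀ hLpos).1 hF3
    linarith
  have hden : (1 - 3 * δ) * L ≤ v ⬝ᵥ v := by
    have hvv : v ⬝ᵥ v = ∑ m ∈ Icc 2 M, x m ^ 2 := dotProduct_self_trial M x
    have hterm : ∑ m ∈ Icc 2 M,
        ((1 - δ) * ((-1 : ℝ) ^ m * (m : ℝ) ^ (-(1 / 2 : ℝ))) ^ 2 - (1 / δ) * e M m ^ 2) ≤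
        ∑ m ∈ Icc 2 M, x m ^ 2 :=
      Finset.sum_le_sum fun m _ => by rw [hxm]; exact sq_add_ge _ _ hδ
    have heta : L - 1 ≤ ∑ m ∈ Icc 2 M, ((-1 : ℝ) ^ m * (m : ℝ) ^ (-(1 / 2 : ℝ))) ^ 2 :=
      log_sub_one_le_sum_eta_sq M hM2
    rw [hvv]
    have hsum : ∑ m ∈ Icc 2 M,
        ((1 - δ) * ((-1 : ℝ) ^ m * (m : ℝ) ^ (-(1 / 2 : ℝ))) ^ 2 - (1 / δ) * e M m ^ 2) =
        (1 - δ) * ∑ m ∈ Icc 2 M, ((-1 : ℝ) ^ m * (m : ℝ) ^ (-(1 / 2 : ℝ))) ^ 2 -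
          (1 / δ) * ∑ m ∈ Icc 2 M, e M m ^ 2 := by
      rw [Finset.sum_sub_distrib, Finset.mul_sum, Finset.mul_sum]
    have h1δ : 0 ≤ 1 - δ := by linarith
    have hδL : 1 ≤ δ * L := by
      have := mul_le_mul_of_nonneg_left hF5 hδ.le
      rwa [mul_one_div_cancel hδ.ne'] at this
    have hE' : (1 / δ) * ∑ m ∈ Icc 2 M, e M m ^ 2 ≤ δ * L := by
      have := mul_le_mul_of_nonneg_left hE (one_div_pos.2 hδ).le
      have hc : (1 / δ) * (δ ^ 2 * L) = δ * L := by field_simp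
      linarith
    linarith only [hterm, hsum, heta, hE', hδL, hδ, mul_le_mul_of_nonneg_left heta h1δ]
  -- conclusion
  have hvv_pos : 0 < v ⬝ᵥ v := by
    have : 0 < (1 - 3 * δ) * L := mul_pos (by linarith) hLpos
    linarith
  refine ⟨v, fun hv0 => ?_, ?_⟩
  · rw [hv0, dotProduct_zero] at hvv_pos
    exact lt_irrefl _ hvv_pos
  · have key : (M : ℝ) * (v ⬝ᵥ (screwMatrix (M - 1)).mulVec v) ≤ (1 / 4 + ε) * (v ⬝ᵥ v) := by
      have p1 := mul_le_mul_of_nonneg_right hδε hLpos.le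
      have p2 := mul_le_mul_of_nonneg_left hden (by positivity : (0 : ℝ) ≤ 1 / 4 + ε)
      linarith [hnum, p1, p2]
    have hR : screwRayleigh M v = (v ⬝ᵥ (screwMatrix (M - 1)).mulVec v) / (v ⬝ᵥ v) := rfl
    rw [hR, ← mul_div_assoc, div_le_iff₀ hvv_pos]
    exact key

end Summit.RiemannHypothesis.RiemannHypothesis.Theorems.EtaLeadingQuarter.Trial

end
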